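import Summits.Parity.GeneralizedHardyLittlewood.Theorems.LeeYangFibresRelativeDimOneTypeDefs
import Literature.NumberTheory.Sieve.LinearEquationsInPrimesLocalObstruction
import Literature.NumberTheory.Sieve.LinearEquationsInPrimesCrudeBounds
import Mathlib.Analysis.SpecialFunctions.Log.Base
import HarnessLib

/-!
# Route `LeeYangFibres`, crux `RelativeDimOne` (stmt-Parity-14113), line `gallagher-backwards-split` (RESHAPED,
# type-conditioned split): singular-weight fact (W2) for the stub `stub_singularWeights`

(W2) LOCAL OBSTRUCTION: if `𝔖(Ψ) = 0` for a non-degenerate `d = 1` system `Ψ` with `‖Ψ‖_N ≤ L`, then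
`S(Ψ, K) = Σ_{n ∈ K ∩ ℤ} ∏_i Λ(ψ_i(n)) ≤ ε N` for `N ≥ N₀(t, L, ε)` and every `K ⊆ [-N, N]`.

Proof. `𝔖 = 0` with `Ψ` non-degenerate forces `β_p = 0` at some prime `p` (`singularProduct_pos_of_localFactor_pos`),
i.e. `g_p = 0` (`goodCount_pos_iff_localFactor_pos`): at every `n` some `ψ_i(n)` is divisible by `p`. If the weight
`∏_i Λ(ψ_i(n))` is non-zero, that `ψ_i(n)` is a prime power divisible by `p`, so `ψ_i(n) = p^k` with `1 ≤ k` and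
`p^k ≤ 2L'N` (`L' = max(L,1)`), whence `k ≤ log₂(2L'N)`; each equation `a_i n + b_i = p^k` has at most one solution
(`card_filter_eval_eq_le`). So at most `t log₂(2L'N)` points contribute, each at most `log^t(2L'N)`
(`prod_intVonMangoldt_le`), and `2t log^{t+1}(2L'N) = o(N)` (`Real.isLittleO_pow_log_id_atTop`).
-/

noncomputable section

open scoped BigOperators Classical Topology
open Finset Filter Literature.NumberTheory.Sieve

namespace Summit.Parity.GeneralizedHardyLittlewood.Cruxes.RelativeDimOne.TypeSplit

namespace SingularWeights

/-! ### Local obstructions -/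

/-- A vanishing singular product of a non-degenerate system comes from a vanishing local factor. -/
theorem exists_localFactor_eq_zero {T : ℕ} {Φ : Fin T → AffLinForm 1} (hΦ : IsNondegenerateSystem Φ)
    (hS : singularProduct Φ = 0) : ∃ p : ℕ, p.Prime ∧ localFactor Φ p = 0 := by
  by_contra h
  push Not at h
  have hpos : ∀ p : ℕ, p.Prime → 0 < localFactor Φ p := fun p hp =>
    lt_of_le_of_ne (localFactor_nonneg Φ p) (fun h0 => h p hp h0.symm)
  exact (singularProduct_pos_of_localFactor_pos Φ hΦ hpos).ne' hS

/-- A vanishing local factor at `p` is a local obstruction: `p` divides some `ψ_i(n)` at every `n`. -/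
theorem exists_dvd_eval_of_localFactor_eq_zero {T : ℕ} (Φ : Fin T → AffLinForm 1) {p : ℕ} (hp : p.Prime)
    (hβ : localFactor Φ p = 0) (n : Fin 1 → ℤ) : ∃ i, (p : ℤ) ∣ (Φ i).eval n := by
  haveI := Fact.mk hp
  have hg : goodCount Φ p = 0 := by
    by_contra h0
    have h1 : 0 < goodCount Φ p := Nat.pos_of_ne_zero h0
    have h2 := (goodCount_pos_iff_localFactor_pos Φ hp).mp h1
    linarith
  unfold goodCount at hg
  rw [Finset.card_eq_zero, Finset.filter_eq_empty_iff] at hg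
  have h1 := hg (Finset.mem_univ (fun j => (n j : ZMod p)))
  push Not at h1
  obtain ⟨i, hi⟩ := h1
  refine ⟨i, ?_⟩
  rw [← ZMod.intCast_zmod_eq_zero_iff_dvd, AffLinForm.intCast_eval]
  exact hi

/-- If the weight `∏_k Λ(ψ_k(n))` is non-zero and `p ∣ ψ_i(n)`, then `ψ_i(n) = p^k` for some `k ≥ 1`. -/
theorem eval_eq_prime_pow {T : ℕ} (Φ : Fin T → AffLinForm 1) {p : ℕ} (hp : p.Prime) {n : Fin 1 → ℤ} {i : Fin T}
    (hdvd : (p : ℤ) ∣ (Φ i).eval n) (hne : ∏ k, intVonMangoldt ((Φ k).eval n) ≠ 0) :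
    ∃ k : ℕ, 1 ≤ k ∧ (Φ i).eval n = (p : ℤ) ^ k := by
  have hi : intVonMangoldt ((Φ i).eval n) ≠ 0 := fun h0 => hne (Finset.prod_eq_zero (Finset.mem_univ i) h0)
  unfold intVonMangoldt at hi
  rw [ArithmeticFunction.vonMangoldt_ne_zero_iff] at hi
  set m := ((Φ i).eval n).toNat with hm
  obtain ⟨q, k, hq, hk, hqk⟩ := hi
  have hq' : q.Prime := Nat.prime_iff.mpr hq
  have hm0 : 0 < m := by
    rw [← hqk]
    exact pow_pos hq'.pos k
  have hpos : 0 < (Φ i).eval n := by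
    by_contra h
    push Not at h
    rw [hm, Int.toNat_eq_zero.mpr h] at hm0
    exact lt_irrefl 0 hm0
  have hmz : ((m : ℕ) : ℤ) = (Φ i).eval n := by
    rw [hm]
    exact Int.toNat_of_nonneg hpos.le
  have hpm : p ∣ m := by
    rw [← Int.natCast_dvd_natCast, hmz]
    exact hdvd
  rw [← hqk] at hpm
  have hpq : p = q := (Nat.prime_dvd_prime_iff_eq hp hq').mp (hp.dvd_of_dvd_pow hpm)
  refine ⟨k, hk, ?_⟩
  rw [← hmz, ← hqk, hpq]
  push_cast
  rfl

/-- The points of `[-N, N]` at which some form takes a value in `{p, p², …, p^K}` number at most `T · K` (each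
equation `a_i n + b_i = p^k` has at most one solution). -/
theorem card_biUnion_eval_pow_le {T : ℕ} (Φ : Fin T → AffLinForm 1) (hΦ : IsNondegenerateSystem Φ) (N : ℕ) (p : ℤ)
    (K : ℕ) :
    #(((univ : Finset (Fin T)) ×ˢ Finset.Icc 1 K).biUnion
        (fun ik => (latticeBox 1 N).filter (fun n => (Φ ik.1).eval n = p ^ ik.2))) ≤ T * K := by
  have hcoeff : ∀ i, (Φ i).coeff 0 ≠ 0 := fun i h0 =>
    hΦ.1 i (funext fun j => by rw [Fin.fin_one_eq_zero j]; exact h0)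
  calc #(((univ : Finset (Fin T)) ×ˢ Finset.Icc 1 K).biUnion
          (fun ik => (latticeBox 1 N).filter (fun n => (Φ ik.1).eval n = p ^ ik.2)))
      ≤ ∑ ik ∈ (univ : Finset (Fin T)) ×ˢ Finset.Icc 1 K,
          #((latticeBox 1 N).filter (fun n => (Φ ik.1).eval n = p ^ ik.2)) := Finset.card_biUnion_le
    _ ≤ ∑ _ik ∈ (univ : Finset (Fin T)) ×ˢ Finset.Icc 1 K, 1 := by
        refine Finset.sum_le_sum fun ik _ => ?_
        have h := card_filter_eval_eq_le (Φ ik.1) (hcoeff ik.1) N (p ^ ik.2)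
        simpa using h
    _ = T * K := by simp

end SingularWeights

open SingularWeights in
/-- **(W2) LOCAL OBSTRUCTION** (registered hook, second conjunct of `SingularWeightFacts`): if `𝔖(Ψ) = 0` for a
non-degenerate `Ψ` with `‖Ψ‖_N ≤ L`, then `S(Ψ, K) ≤ ε N` for `N ≥ N₀(t, L, ε)` and every `K ⊆ [-N, N]`: some prime `p`
divides a form at every point, so only the `≤ t log₂(2L'N)` points with some `ψ_i(n) = p^k` carry weight, each at most
`log^t(2L'N)`, and `log^{t+1} = o(N)`. -/
theorem singularWeights_W2 : ∀ (t L : ℕ), 1 ≤ t → ∀ ε : ℝ, 0 < ε → ∃ N₀ : ℕ, ∀ N : ℕ, N₀ ≤ N → ∀ Ψ : Fin t → AffLinForm 1, IsNondegenerateSystem Ψ → affLinSize Ψ N ≤ L → singularProduct Ψ = 0 → ∀ K : Set (Fin 1 → ℝ), K ⊆ realBox 1 N → vonMangoldtSum Ψ K N ≤ ε * N := by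
  intro t L ht ε hε
  -- constants
  set L₁ : ℕ := max L 1 with hL₁
  have hL₁1 : (1 : ℝ) ≤ L₁ := by exact_mod_cast le_max_right L 1
  have hLL₁ : (L : ℝ) ≤ L₁ := by exact_mod_cast le_max_left L 1
  have ht0 : (0 : ℝ) < t := by exact_mod_cast ht
  set c : ℝ := ε / (4 * t * L₁) with hc
  have hcpos : 0 < c := by positivity
  -- `(log x)^{t+1} = o(x)` along `x = 2 L₁ N`
  have hlo := (Real.isLittleO_pow_log_id_atTop (n := t + 1)).comp_tendsto
    (tendsto_natCast_atTop_atTop.const_mul_atTop (by positivity : (0 : ℝ) < 2 * L₁))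
  have hev : ∀ᶠ N : ℕ in atTop, ‖Real.log (2 * (L₁ : ℝ) * N) ^ (t + 1)‖ ≤ c * ‖(2 * (L₁ : ℝ) * N)‖ :=
    hlo.def hcpos
  obtain ⟨N₁, hN₁⟩ := Filter.eventually_atTop.mp hev
  refine ⟨max N₁ 1, fun N hN Ψ hΨ hL hS K _ => ?_⟩
  have hNN₁ : N₁ ≤ N := le_trans (le_max_left _ _) hN
  have hN1 : 1 ≤ N := le_trans (le_max_right _ _) hN
  have hNr : (1 : ℝ) ≤ N := by exact_mod_cast hN1
  have hL' : affLinSize Ψ N ≤ (L₁ : ℝ) := hL.trans hLL₁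
  set M : ℕ := 2 * L₁ * N with hM
  have hMr : (M : ℝ) = 2 * (L₁ : ℝ) * N := by rw [hM]; push_cast; ring
  have hM1 : (1 : ℝ) ≤ M := by rw [hMr]; nlinarith
  have hlogM : 0 ≤ Real.log M := Real.log_nonneg hM1
  -- a local obstruction
  obtain ⟨p, hp, hβ⟩ := exists_localFactor_eq_zero hΨ hS
  -- the weight and its support
  set F : (Fin 1 → ℤ) → ℝ := fun n => ∏ i, intVonMangoldt ((Ψ i).eval n) with hF
  have hF0 : ∀ n, 0 ≤ F n := fun n => Finset.prod_nonneg fun i _ => intVonMangoldt_nonneg _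
  have hFle : ∀ n ∈ latticeBox 1 N, F n ≤ Real.log M ^ t := fun n hn => by
    rw [hMr]
    exact (prod_intVonMangoldt_le hN1 hL₁1 hL' hn).2
  set Kx : ℕ := Nat.log 2 M with hKx
  set B : Finset (Fin 1 → ℤ) := ((univ : Finset (Fin t)) ×ˢ Finset.Icc 1 Kx).biUnion
      (fun ik => (latticeBox 1 N).filter (fun n => (Ψ ik.1).eval n = (p : ℤ) ^ ik.2)) with hB
  have hsupp : ∀ n ∈ latticeBox 1 N, F n ≠ 0 → n ∈ B := by
    intro n hn hne
    obtain ⟨i, hdvd⟩ := exists_dvd_eval_of_localFactor_eq_zero Ψ hp hβ n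
    obtain ⟨k, hk1, hk⟩ := eval_eq_prime_pow Ψ hp hdvd hne
    have hkK : k ≤ Kx := by
      have habs := abs_eval_le_of_affLinSize_le hN1 hL' hn i
      rw [hk] at habs
      have hpk : ((p ^ k : ℕ) : ℝ) ≤ M := by
        rw [hMr]
        refine le_trans ?_ habs
        push_cast
        exact le_abs_self _
      have hpk' : p ^ k ≤ M := by exact_mod_cast hpk
      exact Nat.le_log_of_pow_le (by norm_num) (le_trans (Nat.pow_le_pow_left hp.two_le k) hpk')
    rw [hB, Finset.mem_biUnion]
    exact ⟨(i, k), Finset.mem_product.mpr ⟨Finset.mem_univ _, Finset.mem_Icc.mpr ⟨hk1, hkK⟩⟩,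
      Finset.mem_filter.mpr ⟨hn, hk⟩⟩
  have hBsub : B ⊆ latticeBox 1 N := by
    intro n hn
    rw [hB, Finset.mem_biUnion] at hn
    obtain ⟨ik, -, hik⟩ := hn
    exact (Finset.mem_filter.mp hik).1
  -- the bound by the support
  have hsum : vonMangoldtSum Ψ K N ≤ ((t * Kx : ℕ) : ℝ) * Real.log M ^ t := by
    unfold vonMangoldtSum
    calc ∑ n ∈ (latticeBox 1 N).filter (fun n => realPoint n ∈ K), F n
        ≤ ∑ n ∈ latticeBox 1 N, F n :=
          Finset.sum_le_sum_of_subset_of_nonneg (Finset.filter_subset _ _) fun n _ _ => hF0 n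
      _ = ∑ n ∈ (latticeBox 1 N).filter (fun n => F n ≠ 0), F n := (Finset.sum_filter_ne_zero _).symm
      _ ≤ ∑ n ∈ B, F n :=
          Finset.sum_le_sum_of_subset_of_nonneg (fun n hn => by
            rw [Finset.mem_filter] at hn
            exact hsupp n hn.1 hn.2) fun n _ _ => hF0 n
      _ ≤ #B • Real.log M ^ t := Finset.sum_le_card_nsmul _ _ _ fun n hn => hFle n (hBsub hn)
      _ ≤ ((t * Kx : ℕ) : ℝ) * Real.log M ^ t := by
          rw [nsmul_eq_mul]
          have h1 : (#B : ℝ) ≤ ((t * Kx : ℕ) : ℝ) := by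
            exact_mod_cast card_biUnion_eval_pow_le Ψ hΨ N p Kx
          exact mul_le_mul_of_nonneg_right h1 (pow_nonneg hlogM t)
  -- numerics: `t K_x log^t M ≤ 2t log^{t+1} M ≤ 2 t c M = ε N`
  have hKx2 : (Kx : ℝ) ≤ 2 * Real.log M := by
    have h1 : (Kx : ℝ) ≤ Real.logb 2 M := by
      rw [hKx]
      exact_mod_cast Real.natLog_le_logb M 2
    have h2 : Real.logb 2 M = Real.log M / Real.log 2 := rfl
    rw [h2] at h1
    have hl2 : (1 / 2 : ℝ) < Real.log 2 := by
      have := Real.log_two_gt_d9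
      linarith
    calc (Kx : ℝ) ≤ Real.log M / Real.log 2 := h1
      _ ≤ Real.log M / (1 / 2) := div_le_div_of_nonneg_left hlogM (by norm_num) hl2.le
      _ = 2 * Real.log M := by ring
  have hmain := hN₁ N hNN₁
  rw [Real.norm_eq_abs, Real.norm_eq_abs, ← hMr, abs_of_nonneg (pow_nonneg hlogM _),
    abs_of_nonneg (by positivity)] at hmain
  have hL₁0 : (0 : ℝ) < L₁ := by linarith
  calc vonMangoldtSum Ψ K N ≤ ((t * Kx : ℕ) : ℝ) * Real.log M ^ t := hsum
    _ ≤ (t : ℝ) * (2 * Real.log M) * Real.log M ^ t := by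
        push_cast
        exact mul_le_mul_of_nonneg_right (mul_le_mul_of_nonneg_left hKx2 ht0.le) (pow_nonneg hlogM t)
    _ = 2 * t * Real.log M ^ (t + 1) := by ring
    _ ≤ 2 * t * (c * M) := by gcongr
    _ = ε * N := by
        rw [hc, hMr]
        field_simp
        ring

end Summit.Parity.GeneralizedHardyLittlewood.Cruxes.RelativeDimOne.TypeSplit

end
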